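import Literature.NumberTheory.Automorphic.CuspidalGL2EulerProductConvergence
import Literature.NumberTheory.Automorphic.PiOfArtinRepAtSigmaUnramifiedPlacesOfGlobalHeckeTheoryProofs
import HarnessLib

/-!
# The global analytic clause (an) of the standard `L`-function theory of cuspidal `GL(2)` from an
# integral representation: meromorphic continuation and functional equation out of the Euler
# factorisation, the global and the local functional equations of the Hecke integrals
# (Jacquet–Langlands 1970, proof of Thm. 11.1, pp. 172–173)

Topic `Literature/NumberTheory/Automorphic`; proof file (theorems only: no definition, no named
fact, no instance).  The last step of Jacquet–Langlands' proof of Thm. 11.1 for a constituent `π` of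
the space of cusp forms (PDF pp. 172–173 of the held retypeset edition), isolated as pure complex
analysis.  In print: for `φ₁ = ⊗ φ_v` in the Whittaker model, the Hecke integral
`Ψ(g, s, φ₁) = ∫ φ(diag(a,1) g) |a|^{s-1/2} d^×a` is entire (Lemma 11.1.3), factors for `Re s` large
as `Ψ(g, s, φ₁) = L(s, π) Φ(g, s, φ₁)` with `Φ = ∏_v Φ(g_v, s, φ_v)` a finite product of local
quotients `Ψ_v / L(s, π_v)` ("junk", entire), satisfies the global functional equation
`Ψ̃(wg, 1 - s, φ₁) = Ψ(g, s, φ₁)` (`φ(wh) = φ(h)` and `a ↦ a⁻¹`), and the local functional equations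
turn `∏_v Φ̃(w, 1 - s, φ_v)` into `∏_v {ε(s, π_v, ψ_v) Φ(e, s, φ_v)}`; choosing `φ_v` with
`Φ(e, s, φ_v)` an exponential and "cancelling the term `∏_v Φ(e, s, φ_v)`" gives
`L(s, π) = ε(s, π) L(1 - s, π̃)`.

`exists_meromorphic_functionalEquation_of_integralRepresentation` is that paragraph over an
arbitrary index set of places and arbitrary "Euler factor values" `A u s`, `A' u s`
(`= P_u(q_u^{-s})`, `P'_u(q_u^{-s})`): GIVEN

* (conv) multipliability of `u ↦ (A u s)⁻¹`, `u ↦ (A' u s)⁻¹` without zero factor for `re s > c₀`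
  (Thm. 11.1, first assertion — for the canonical local Euler polynomials of a cuspidal `π` on
  `GL₂(𝔸_F)` this is the theorem `exists_multipliable_inv_eval_localEulerPolynomial` of
  `CuspidalGL2EulerProductConvergence`);
* (int) entire functions `Z, Z'` (the Hecke integrals of `φ` and of `φ̃ = φ ∘ ι`, Lemma 11.1.3;
  in the tree `differentiable_jpssIntegral_of_isCuspFormGL`, `JPSSGlobalIntegral`), entire `J, J'`
  (the junk `∏_v Φ(e, s, φ_v)`, `∏_v Φ̃(w, s, φ_v)` including the archimedean quotients) and entire
  `Γ, Γ'` with zeros on finitely many horizontal lines (`1 / L_∞(s, π)`, `1 / L_∞(s, π̃)`);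
* (Euler) `Z(s) Γ(s) = J(s) ∏'_u (A u s)⁻¹` and `Z'(s) Γ'(s) = J'(s) ∏'_u (A' u s)⁻¹` with
  `J(s), J'(s) ≠ 0`, for `re s > c₀` (the Euler factorisation `Ψ = L(s, π) Φ` for the good choice
  of `φ_v`);
* (FE) `Z(s) = Z'(1 - s)` for all `s` (the global functional equation; in the tree
  `jpssIntegral_eq_jpssIntegral_comp_glTransposeInvQuot_one_sub`, `JPSSGlobalFunctionalEquation`);
* (locFE) `J'(1 - s) = η(s) J(s)` with `η` continuous and nowhere zero (the product of the local
  functional equations, `η = ∏_v ε(s, π_v, ψ_v)`),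

THEN `Λ := Z / J`, `Λ' := Z' / J'`, `ε := η`, `c := max(1, c₀)` satisfy clause (an) verbatim:
`Λ, Λ'` meromorphic, `Λ Γ = ∏' (A u s)⁻¹` and `Λ' Γ' = ∏' (A' u s)⁻¹` on `re s > c`, and
`Λ(s) = ε(s) Λ'(1 - s)` for ALL `s` (at a zero of `J` both sides vanish, `J'(1 - s) = η(s) J(s)`).

`globalHeckeTheoryGL2_an_of_integralRepresentation` specialises to a cuspidal `π` on `GL₂(𝔸_F)`
and families `P, P'` with the universal property of the canonical local Euler polynomials of `π`
and of `π^τ = π.transposeInv` ((conv) discharged by `exists_multipliable_inv_eval_localEulerPolynomial`),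
concluding the `∃ Λ Λ' Γ Γ' ε c` block of the hypothesis `hR1` of
`JacquetLanglands1970_standardLTheoryGL2_of_globalHeckeTheory` VERBATIM; whence the named facts
`JacquetLanglands1970_standardLTheoryGL2`, `JacquetLanglands1970_twistedHeckeTheoryGL2` and
`frobSatakeCompatibleAt_of_isPiOfArtinRep_of_isUnramifiedAt` from the displayed
integral-representation package (IR) alone (`…_of_integralRepresentation`).  What (IR) still asks
of the tree: the Eulerian factorisation of the `GL₂ × GL₁` Hecke integral of a pure tensor with the
unramified computation and good test vectors at the bad places, the finite-place local functional
equations (Jacquet–Langlands Thm. 2.18 (iv)) and the archimedean local theory (§§5–6).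

## Main results

* `exists_meromorphic_functionalEquation_of_integralRepresentation` (abstract assembly).
* `globalHeckeTheoryGL2_an_of_integralRepresentation` (clause (an) of `hR1` for `GL₂`).
* `JacquetLanglands1970_standardLTheoryGL2_of_integralRepresentation`,
  `JacquetLanglands1970_twistedHeckeTheoryGL2_of_integralRepresentation`,
  `frobSatakeCompatibleAt_of_isPiOfArtinRep_of_isUnramifiedAt_of_integralRepresentation`.

## References

* H. Jacquet, R. P. Langlands, *Automorphic Forms on GL(2)*, Lecture Notes in Math. 114, Springer
  (1970), Thm. 11.1 and its proof, Lemma 11.1.3, pp. 168–173 of the authors' retypeset edition.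
  [JacquetLanglands1970]
* S. Gelbart, *Three lectures on the modularity of ρ̄_{E,3} and the Langlands reciprocity
  conjecture* (1997), Prop. 4.1 (the consumer). [Gelbart1997]
-/

noncomputable section

open scoped MatrixGroups NNReal Classical
open MeasureTheory NumberField IsDedekindDomain Polynomial Filter Complex

namespace Literature.NumberTheory.Automorphic

/-! ### The abstract assembly -/

section Abstract

/-- **Jacquet–Langlands 1970, proof of Thm. 11.1, last step (pp. 172–173), as complex analysis.**
Euler factorisations `Z Γ = J · ∏'(A u s)⁻¹`, `Z' Γ' = J' · ∏'(A' u s)⁻¹` with non-vanishing junk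
`J, J'` on `re s > c₀`, entire `Z, Z', J, J'`, the global functional equation `Z(s) = Z'(1 - s)`
and the aggregated local functional equations `J'(1 - s) = η(s) J(s)` (`η` continuous, nowhere
zero) yield meromorphic `Λ = Z / J`, `Λ' = Z' / J'` with `Λ Γ = ∏'(A u s)⁻¹`, `Λ' Γ' = ∏'(A' u s)⁻¹`
on `re s > max(1, c₀)` and `Λ(s) = η(s) Λ'(1 - s)` everywhere ("cancelling the term
`∏_v Φ(e, s, φ_v)`"). [cite: JacquetLanglands1970, proof of Thm. 11.1, pp. 172–173] -/
theorem exists_meromorphic_functionalEquation_of_integralRepresentation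
    {ι : Type*} {A A' : ι → ℂ → ℂ} {c₀ : ℝ}
    (hA : ∀ s : ℂ, c₀ < s.re → (Multipliable fun u => (A u s)⁻¹) ∧ ∀ u, A u s ≠ 0)
    (hA' : ∀ s : ℂ, c₀ < s.re → (Multipliable fun u => (A' u s)⁻¹) ∧ ∀ u, A' u s ≠ 0)
    {Z Z' J J' Γ Γ' η : ℂ → ℂ}
    (hZ : Differentiable ℂ Z) (hZ' : Differentiable ℂ Z')
    (hJ : Differentiable ℂ J) (hJ' : Differentiable ℂ J')
    (hΓ : Differentiable ℂ Γ) (hΓ' : Differentiable ℂ Γ')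
    (hΓY : ∃ Y : Set ℝ, Y.Finite ∧ ∀ s, Γ s = 0 → s.im ∈ Y)
    (hΓ'Y : ∃ Y : Set ℝ, Y.Finite ∧ ∀ s, Γ' s = 0 → s.im ∈ Y)
    (hE : ∀ s : ℂ, c₀ < s.re → J s ≠ 0 ∧ Z s * Γ s = J s * ∏' u, (A u s)⁻¹)
    (hE' : ∀ s : ℂ, c₀ < s.re → J' s ≠ 0 ∧ Z' s * Γ' s = J' s * ∏' u, (A' u s)⁻¹)
    (hFE : ∀ s, Z s = Z' (1 - s))
    (hη : Continuous η) (hη0 : ∀ s, η s ≠ 0) (hJJ' : ∀ s, J' (1 - s) = η s * J s) :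
    ∃ (Λ Λ' Γ Γ' ε : ℂ → ℂ) (c : ℝ),
      Meromorphic Λ ∧ Meromorphic Λ' ∧ Differentiable ℂ Γ ∧ Differentiable ℂ Γ' ∧
      (∃ Y : Set ℝ, Y.Finite ∧ ∀ s, Γ s = 0 → s.im ∈ Y) ∧
      (∃ Y : Set ℝ, Y.Finite ∧ ∀ s, Γ' s = 0 → s.im ∈ Y) ∧
      Continuous ε ∧ (∀ s, ε s ≠ 0) ∧ 1 ≤ c ∧
      (∀ s : ℂ, c < s.re →
        (Multipliable fun u => (A u s)⁻¹) ∧ (∀ u, A u s ≠ 0) ∧ Λ s * Γ s = ∏' u, (A u s)⁻¹) ∧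
      (∀ s : ℂ, c < s.re →
        (Multipliable fun u => (A' u s)⁻¹) ∧ (∀ u, A' u s ≠ 0) ∧ Λ' s * Γ' s = ∏' u, (A' u s)⁻¹) ∧
      (∀ s, Λ s = ε s * Λ' (1 - s)) := by
  have hc : ∀ s : ℂ, max 1 c₀ < s.re → c₀ < s.re := fun s hs => (le_max_right _ _).trans_lt hs
  refine ⟨Z / J, Z' / J', Γ, Γ', η, max 1 c₀,
    fun x => (hZ.analyticAt x).meromorphicAt.div (hJ.analyticAt x).meromorphicAt,
    fun x => (hZ'.analyticAt x).meromorphicAt.div (hJ'.analyticAt x).meromorphicAt,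
    hΓ, hΓ', hΓY, hΓ'Y, hη, hη0, le_max_left _ _,
    fun s hs => ⟨(hA s (hc s hs)).1, (hA s (hc s hs)).2, ?_⟩,
    fun s hs => ⟨(hA' s (hc s hs)).1, (hA' s (hc s hs)).2, ?_⟩, fun s => ?_⟩
  · -- `Λ Γ = (Z Γ) / J = ∏' (A u s)⁻¹`
    rw [Pi.div_apply, div_mul_eq_mul_div, (hE s (hc s hs)).2,
      mul_div_cancel_left₀ _ (hE s (hc s hs)).1]
  · rw [Pi.div_apply, div_mul_eq_mul_div, (hE' s (hc s hs)).2,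
      mul_div_cancel_left₀ _ (hE' s (hc s hs)).1]
  · -- the functional equation: `Z(s)/J(s) = η(s) Z'(1-s)/J'(1-s) = η(s) Z(s)/(η(s) J(s))`
    simp only [Pi.div_apply]
    rw [← hFE s, hJJ' s, mul_comm (η s) (J s), ← mul_div_assoc, mul_comm (η s) (Z s),
      mul_div_mul_right _ _ (hη0 s)]

end Abstract

/-! ### Clause (an) for cuspidal `GL₂` from an integral representation -/

section GL2

variable {F : Type} [Field F] [NumberField F] {hcpt : isCompact_glFiniteIntegralLevel 2 F}

/-- **Clause (an) of `hR1` from an integral representation** (Jacquet–Langlands 1970, proof of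
Thm. 11.1, pp. 171–173): for a cuspidal `π` on `GL₂(𝔸_F)` and families `P, P'` with the universal
property of the canonical local Euler polynomials of `π` and of `π^τ`, the data (int), (Euler),
(FE), (locFE) of the module docstring yield the `∃ Λ Λ' Γ Γ' ε c` block of the hypothesis `hR1` of
`JacquetLanglands1970_standardLTheoryGL2_of_globalHeckeTheory` verbatim — the convergence
conjuncts being `exists_multipliable_inv_eval_localEulerPolynomial` (Thm. 11.1, first assertion).
[cite: JacquetLanglands1970, Thm. 11.1 and its proof, pp. 168–173] -/
theorem globalHeckeTheoryGL2_an_of_integralRepresentation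
    (π : CuspidalAutomorphicRepData 2 F hcpt) (P P' : HeightOneSpectrum (𝓞 F) → ℂ[X])
    (hP : ∀ (u : HeightOneSpectrum (𝓞 F)) (πu : SmoothIrrep (GL (Fin 2) (u.adicCompletion F))),
      π.1.HasLocalComponentAt u πu.ρ →
      ∀ (ψ : AddChar (u.adicCompletion F) Circle), ψ.IsContinuousNontrivial →
      ∀ [MeasurableSpace (u.adicCompletion F)] [BorelSpace (u.adicCompletion F)]
        [MeasurableSpace (GL (Fin 1) (u.adicCompletion F) ⧸ upperUnitriangular (Fin 1) (u.adicCompletion F))]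
        [BorelSpace (GL (Fin 1) (u.adicCompletion F) ⧸ upperUnitriangular (Fin 1) (u.adicCompletion F))]
        (ν : Measure (GL (Fin 1) (u.adicCompletion F) ⧸ upperUnitriangular (Fin 1) (u.adicCompletion F)))
        [SMulInvariantMeasure (GL (Fin 1) (u.adicCompletion F))
          (GL (Fin 1) (u.adicCompletion F) ⧸ upperUnitriangular (Fin 1) (u.adicCompletion F)) ν]
        [IsFiniteMeasureOnCompacts ν] [ν.IsOpenPosMeasure],
        HasRSLFactor Nat.one_lt_two πu.ρ
          (Representation.trivial ℂ (GL (Fin 1) (u.adicCompletion F)) ℂ) ψ ν (P u))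
    (hP' : ∀ (u : HeightOneSpectrum (𝓞 F)) (πu : SmoothIrrep (GL (Fin 2) (u.adicCompletion F))),
      π.transposeInv.1.HasLocalComponentAt u πu.ρ →
      ∀ (ψ : AddChar (u.adicCompletion F) Circle), ψ.IsContinuousNontrivial →
      ∀ [MeasurableSpace (u.adicCompletion F)] [BorelSpace (u.adicCompletion F)]
        [MeasurableSpace (GL (Fin 1) (u.adicCompletion F) ⧸ upperUnitriangular (Fin 1) (u.adicCompletion F))]
        [BorelSpace (GL (Fin 1) (u.adicCompletion F) ⧸ upperUnitriangular (Fin 1) (u.adicCompletion F))]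
        (ν : Measure (GL (Fin 1) (u.adicCompletion F) ⧸ upperUnitriangular (Fin 1) (u.adicCompletion F)))
        [SMulInvariantMeasure (GL (Fin 1) (u.adicCompletion F))
          (GL (Fin 1) (u.adicCompletion F) ⧸ upperUnitriangular (Fin 1) (u.adicCompletion F)) ν]
        [IsFiniteMeasureOnCompacts ν] [ν.IsOpenPosMeasure],
        HasRSLFactor Nat.one_lt_two πu.ρ
          (Representation.trivial ℂ (GL (Fin 1) (u.adicCompletion F)) ℂ) ψ ν (P' u))
    {c₀ : ℝ} {Z Z' J J' Γ Γ' η : ℂ → ℂ}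
    (hZ : Differentiable ℂ Z) (hZ' : Differentiable ℂ Z')
    (hJ : Differentiable ℂ J) (hJ' : Differentiable ℂ J')
    (hΓ : Differentiable ℂ Γ) (hΓ' : Differentiable ℂ Γ')
    (hΓY : ∃ Y : Set ℝ, Y.Finite ∧ ∀ s, Γ s = 0 → s.im ∈ Y)
    (hΓ'Y : ∃ Y : Set ℝ, Y.Finite ∧ ∀ s, Γ' s = 0 → s.im ∈ Y)
    (hE : ∀ s : ℂ, c₀ < s.re → J s ≠ 0 ∧ Z s * Γ s =
      J s * ∏' u : HeightOneSpectrum (𝓞 F), ((P u).eval ((u.residueCard : ℂ) ^ (-s)))⁻¹)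
    (hE' : ∀ s : ℂ, c₀ < s.re → J' s ≠ 0 ∧ Z' s * Γ' s =
      J' s * ∏' u : HeightOneSpectrum (𝓞 F), ((P' u).eval ((u.residueCard : ℂ) ^ (-s)))⁻¹)
    (hFE : ∀ s, Z s = Z' (1 - s))
    (hη : Continuous η) (hη0 : ∀ s, η s ≠ 0) (hJJ' : ∀ s, J' (1 - s) = η s * J s) :
    ∃ (Λ Λ' Γ Γ' ε : ℂ → ℂ) (c : ℝ),
      Meromorphic Λ ∧ Meromorphic Λ' ∧ Differentiable ℂ Γ ∧ Differentiable ℂ Γ' ∧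
      (∃ Y : Set ℝ, Y.Finite ∧ ∀ s, Γ s = 0 → s.im ∈ Y) ∧
      (∃ Y : Set ℝ, Y.Finite ∧ ∀ s, Γ' s = 0 → s.im ∈ Y) ∧
      Continuous ε ∧ (∀ s, ε s ≠ 0) ∧ 1 ≤ c ∧
      (∀ s : ℂ, c < s.re →
        (Multipliable fun u : HeightOneSpectrum (𝓞 F) =>
            ((P u).eval ((u.residueCard : ℂ) ^ (-s)))⁻¹) ∧
          (∀ u, (P u).eval ((u.residueCard : ℂ) ^ (-s)) ≠ 0) ∧
          Λ s * Γ s =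
            ∏' u : HeightOneSpectrum (𝓞 F), ((P u).eval ((u.residueCard : ℂ) ^ (-s)))⁻¹) ∧
      (∀ s : ℂ, c < s.re →
        (Multipliable fun u : HeightOneSpectrum (𝓞 F) =>
            ((P' u).eval ((u.residueCard : ℂ) ^ (-s)))⁻¹) ∧
          (∀ u, (P' u).eval ((u.residueCard : ℂ) ^ (-s)) ≠ 0) ∧
          Λ' s * Γ' s =
            ∏' u : HeightOneSpectrum (𝓞 F), ((P' u).eval ((u.residueCard : ℂ) ^ (-s)))⁻¹) ∧
      (∀ s, Λ s = ε s * Λ' (1 - s)) := by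
  -- (conv): Thm. 11.1, first assertion, for `π` and for `π^τ`
  obtain ⟨c₁, -, h₁⟩ := exists_multipliable_inv_eval_localEulerPolynomial π P hP
  obtain ⟨c₂, -, h₂⟩ := exists_multipliable_inv_eval_localEulerPolynomial π.transposeInv P' hP'
  have k₀ : ∀ s : ℂ, max c₀ (max c₁ c₂) < s.re → c₀ < s.re := fun s hs =>
    (le_max_left _ _).trans_lt hs
  have k₁ : ∀ s : ℂ, max c₀ (max c₁ c₂) < s.re → c₁ < s.re := fun s hs =>
    ((le_max_left _ _).trans (le_max_right _ _)).trans_lt hs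
  have k₂ : ∀ s : ℂ, max c₀ (max c₁ c₂) < s.re → c₂ < s.re := fun s hs =>
    ((le_max_right _ _).trans (le_max_right _ _)).trans_lt hs
  exact exists_meromorphic_functionalEquation_of_integralRepresentation
    (A := fun u s => (P u).eval ((u.residueCard : ℂ) ^ (-s)))
    (A' := fun u s => (P' u).eval ((u.residueCard : ℂ) ^ (-s))) (c₀ := max c₀ (max c₁ c₂))
    (fun s hs => h₁ s (k₁ s hs)) (fun s hs => h₂ s (k₂ s hs)) hZ hZ' hJ hJ' hΓ hΓ' hΓY hΓ'Y
    (fun s hs => hE s (k₀ s hs)) (fun s hs => hE' s (k₀ s hs)) hFE hη hη0 hJJ'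

end GL2

/-! ### The named facts from the integral-representation package (IR) -/

section Facts

/-- **`JacquetLanglands1970_standardLTheoryGL2` from the integral representation of `L(s, π)`**:
if for every cuspidal `π` on `GL₂(𝔸_F)` and all families `P, P'` with the universal property of
the canonical local Euler polynomials of `π` and `π^τ` there are entire `Z, Z', J, J'`, entire
`Γ, Γ'` with zeros on finitely many horizontal lines, `c₀` and a continuous nowhere-zero `η` with
the Euler factorisations `Z Γ = J ∏' P_u(q_u^{-s})⁻¹`, `Z' Γ' = J' ∏' P'_u(q_u^{-s})⁻¹`
(`J, J' ≠ 0`) on `re s > c₀`, the global functional equation `Z(s) = Z'(1 - s)` and the aggregated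
local functional equations `J'(1 - s) = η(s) J(s)` (Jacquet–Langlands 1970, Lemma 11.1.3 and
pp. 171–173, for the `GL₂ × GL₁` Hecke integrals of a good pure tensor of `π` and its
`ι`-transform), then the standard `L`-function theory of cuspidal `GL(2)` holds
(`JacquetLanglands1970_standardLTheoryGL2_of_globalHeckeTheory` with
`globalHeckeTheoryGL2_an_of_integralRepresentation`).
[cite: JacquetLanglands1970, Thm. 11.1, Lemma 11.1.3, pp. 168–173] -/
theorem JacquetLanglands1970_standardLTheoryGL2_of_integralRepresentation
    (hIR : ∀ {F : Type} [Field F] [NumberField F] (hcpt : isCompact_glFiniteIntegralLevel 2 F)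
      (π : CuspidalAutomorphicRepData 2 F hcpt) (P P' : HeightOneSpectrum (𝓞 F) → ℂ[X]),
      (∀ (u : HeightOneSpectrum (𝓞 F)) (πu : SmoothIrrep (GL (Fin 2) (u.adicCompletion F))),
        π.1.HasLocalComponentAt u πu.ρ →
        ∀ (ψ : AddChar (u.adicCompletion F) Circle), ψ.IsContinuousNontrivial →
        ∀ [MeasurableSpace (u.adicCompletion F)] [BorelSpace (u.adicCompletion F)]
          [MeasurableSpace (GL (Fin 1) (u.adicCompletion F) ⧸ upperUnitriangular (Fin 1) (u.adicCompletion F))]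
          [BorelSpace (GL (Fin 1) (u.adicCompletion F) ⧸ upperUnitriangular (Fin 1) (u.adicCompletion F))]
          (ν : Measure (GL (Fin 1) (u.adicCompletion F) ⧸ upperUnitriangular (Fin 1) (u.adicCompletion F)))
          [SMulInvariantMeasure (GL (Fin 1) (u.adicCompletion F))
            (GL (Fin 1) (u.adicCompletion F) ⧸ upperUnitriangular (Fin 1) (u.adicCompletion F)) ν]
          [IsFiniteMeasureOnCompacts ν] [ν.IsOpenPosMeasure],
          HasRSLFactor Nat.one_lt_two πu.ρ
            (Representation.trivial ℂ (GL (Fin 1) (u.adicCompletion F)) ℂ) ψ ν (P u)) →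
      (∀ (u : HeightOneSpectrum (𝓞 F)) (πu : SmoothIrrep (GL (Fin 2) (u.adicCompletion F))),
        π.transposeInv.1.HasLocalComponentAt u πu.ρ →
        ∀ (ψ : AddChar (u.adicCompletion F) Circle), ψ.IsContinuousNontrivial →
        ∀ [MeasurableSpace (u.adicCompletion F)] [BorelSpace (u.adicCompletion F)]
          [MeasurableSpace (GL (Fin 1) (u.adicCompletion F) ⧸ upperUnitriangular (Fin 1) (u.adicCompletion F))]
          [BorelSpace (GL (Fin 1) (u.adicCompletion F) ⧸ upperUnitriangular (Fin 1) (u.adicCompletion F))]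
          (ν : Measure (GL (Fin 1) (u.adicCompletion F) ⧸ upperUnitriangular (Fin 1) (u.adicCompletion F)))
          [SMulInvariantMeasure (GL (Fin 1) (u.adicCompletion F))
            (GL (Fin 1) (u.adicCompletion F) ⧸ upperUnitriangular (Fin 1) (u.adicCompletion F)) ν]
          [IsFiniteMeasureOnCompacts ν] [ν.IsOpenPosMeasure],
          HasRSLFactor Nat.one_lt_two πu.ρ
            (Representation.trivial ℂ (GL (Fin 1) (u.adicCompletion F)) ℂ) ψ ν (P' u)) →
      ∃ (c₀ : ℝ) (Z Z' J J' Γ Γ' η : ℂ → ℂ),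
        Differentiable ℂ Z ∧ Differentiable ℂ Z' ∧ Differentiable ℂ J ∧ Differentiable ℂ J' ∧
        Differentiable ℂ Γ ∧ Differentiable ℂ Γ' ∧
        (∃ Y : Set ℝ, Y.Finite ∧ ∀ s, Γ s = 0 → s.im ∈ Y) ∧
        (∃ Y : Set ℝ, Y.Finite ∧ ∀ s, Γ' s = 0 → s.im ∈ Y) ∧
        (∀ s : ℂ, c₀ < s.re → J s ≠ 0 ∧ Z s * Γ s =
          J s * ∏' u : HeightOneSpectrum (𝓞 F), ((P u).eval ((u.residueCard : ℂ) ^ (-s)))⁻¹) ∧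
        (∀ s : ℂ, c₀ < s.re → J' s ≠ 0 ∧ Z' s * Γ' s =
          J' s * ∏' u : HeightOneSpectrum (𝓞 F), ((P' u).eval ((u.residueCard : ℂ) ^ (-s)))⁻¹) ∧
        (∀ s, Z s = Z' (1 - s)) ∧
        Continuous η ∧ (∀ s, η s ≠ 0) ∧ (∀ s, J' (1 - s) = η s * J s)) :
    JacquetLanglands1970_standardLTheoryGL2 := by
  refine JacquetLanglands1970_standardLTheoryGL2_of_globalHeckeTheory ?_
  intro F _ _ hcpt π P P' hP hP'
  obtain ⟨c₀, Z, Z', J, J', Γ, Γ', η, hZ, hZ', hJ, hJ', hΓ, hΓ', hΓY, hΓ'Y, hE, hE', hFE, hη, hη0,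
    hJJ'⟩ := hIR hcpt π P P' hP hP'
  exact globalHeckeTheoryGL2_an_of_integralRepresentation π P P' hP hP' hZ hZ' hJ hJ' hΓ hΓ' hΓY
    hΓ'Y hE hE' hFE hη hη0 hJJ'

/-- **`JacquetLanglands1970_twistedHeckeTheoryGL2` from the integral-representation package (IR)**
(through `JacquetLanglands1970_standardLTheoryGL2_of_integralRepresentation` and the accepted
reduction `JacquetLanglands1970_twistedHeckeTheoryGL2_of_JacquetLanglands1970_standardLTheoryGL2`).
[cite: JacquetLanglands1970, Thm. 11.1, Thm. 12.2] -/
theorem JacquetLanglands1970_twistedHeckeTheoryGL2_of_integralRepresentation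
    (hIR : ∀ {F : Type} [Field F] [NumberField F] (hcpt : isCompact_glFiniteIntegralLevel 2 F)
      (π : CuspidalAutomorphicRepData 2 F hcpt) (P P' : HeightOneSpectrum (𝓞 F) → ℂ[X]),
      (∀ (u : HeightOneSpectrum (𝓞 F)) (πu : SmoothIrrep (GL (Fin 2) (u.adicCompletion F))),
        π.1.HasLocalComponentAt u πu.ρ →
        ∀ (ψ : AddChar (u.adicCompletion F) Circle), ψ.IsContinuousNontrivial →
        ∀ [MeasurableSpace (u.adicCompletion F)] [BorelSpace (u.adicCompletion F)]
          [MeasurableSpace (GL (Fin 1) (u.adicCompletion F) ⧸ upperUnitriangular (Fin 1) (u.adicCompletion F))]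
          [BorelSpace (GL (Fin 1) (u.adicCompletion F) ⧸ upperUnitriangular (Fin 1) (u.adicCompletion F))]
          (ν : Measure (GL (Fin 1) (u.adicCompletion F) ⧸ upperUnitriangular (Fin 1) (u.adicCompletion F)))
          [SMulInvariantMeasure (GL (Fin 1) (u.adicCompletion F))
            (GL (Fin 1) (u.adicCompletion F) ⧸ upperUnitriangular (Fin 1) (u.adicCompletion F)) ν]
          [IsFiniteMeasureOnCompacts ν] [ν.IsOpenPosMeasure],
          HasRSLFactor Nat.one_lt_two πu.ρ
            (Representation.trivial ℂ (GL (Fin 1) (u.adicCompletion F)) ℂ) ψ ν (P u)) →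
      (∀ (u : HeightOneSpectrum (𝓞 F)) (πu : SmoothIrrep (GL (Fin 2) (u.adicCompletion F))),
        π.transposeInv.1.HasLocalComponentAt u πu.ρ →
        ∀ (ψ : AddChar (u.adicCompletion F) Circle), ψ.IsContinuousNontrivial →
        ∀ [MeasurableSpace (u.adicCompletion F)] [BorelSpace (u.adicCompletion F)]
          [MeasurableSpace (GL (Fin 1) (u.adicCompletion F) ⧸ upperUnitriangular (Fin 1) (u.adicCompletion F))]
          [BorelSpace (GL (Fin 1) (u.adicCompletion F) ⧸ upperUnitriangular (Fin 1) (u.adicCompletion F))]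
          (ν : Measure (GL (Fin 1) (u.adicCompletion F) ⧸ upperUnitriangular (Fin 1) (u.adicCompletion F)))
          [SMulInvariantMeasure (GL (Fin 1) (u.adicCompletion F))
            (GL (Fin 1) (u.adicCompletion F) ⧸ upperUnitriangular (Fin 1) (u.adicCompletion F)) ν]
          [IsFiniteMeasureOnCompacts ν] [ν.IsOpenPosMeasure],
          HasRSLFactor Nat.one_lt_two πu.ρ
            (Representation.trivial ℂ (GL (Fin 1) (u.adicCompletion F)) ℂ) ψ ν (P' u)) →
      ∃ (c₀ : ℝ) (Z Z' J J' Γ Γ' η : ℂ → ℂ),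
        Differentiable ℂ Z ∧ Differentiable ℂ Z' ∧ Differentiable ℂ J ∧ Differentiable ℂ J' ∧
        Differentiable ℂ Γ ∧ Differentiable ℂ Γ' ∧
        (∃ Y : Set ℝ, Y.Finite ∧ ∀ s, Γ s = 0 → s.im ∈ Y) ∧
        (∃ Y : Set ℝ, Y.Finite ∧ ∀ s, Γ' s = 0 → s.im ∈ Y) ∧
        (∀ s : ℂ, c₀ < s.re → J s ≠ 0 ∧ Z s * Γ s =
          J s * ∏' u : HeightOneSpectrum (𝓞 F), ((P u).eval ((u.residueCard : ℂ) ^ (-s)))⁻¹) ∧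
        (∀ s : ℂ, c₀ < s.re → J' s ≠ 0 ∧ Z' s * Γ' s =
          J' s * ∏' u : HeightOneSpectrum (𝓞 F), ((P' u).eval ((u.residueCard : ℂ) ^ (-s)))⁻¹) ∧
        (∀ s, Z s = Z' (1 - s)) ∧
        Continuous η ∧ (∀ s, η s ≠ 0) ∧ (∀ s, J' (1 - s) = η s * J s)) :
    JacquetLanglands1970_twistedHeckeTheoryGL2 :=
  JacquetLanglands1970_twistedHeckeTheoryGL2_of_JacquetLanglands1970_standardLTheoryGL2
    (JacquetLanglands1970_standardLTheoryGL2_of_integralRepresentation hIR)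

/-- **Gelbart's Prop. 4.1, `σ`-unramified shadow (`frobSatakeCompatibleAt_of_isPiOfArtinRep_of_isUnramifiedAt`),
from the integral-representation package (IR)** (through
`JacquetLanglands1970_standardLTheoryGL2_of_integralRepresentation` and the accepted reduction
`frobSatakeCompatibleAt_of_isPiOfArtinRep_of_isUnramifiedAt_of_JacquetLanglands1970_standardLTheoryGL2`).
[cite: Gelbart1997, Prop. 4.1] [cite: JacquetLanglands1970, Thm. 11.1, Thm. 12.2] -/
theorem frobSatakeCompatibleAt_of_isPiOfArtinRep_of_isUnramifiedAt_of_integralRepresentation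
    (hIR : ∀ {F : Type} [Field F] [NumberField F] (hcpt : isCompact_glFiniteIntegralLevel 2 F)
      (π : CuspidalAutomorphicRepData 2 F hcpt) (P P' : HeightOneSpectrum (𝓞 F) → ℂ[X]),
      (∀ (u : HeightOneSpectrum (𝓞 F)) (πu : SmoothIrrep (GL (Fin 2) (u.adicCompletion F))),
        π.1.HasLocalComponentAt u πu.ρ →
        ∀ (ψ : AddChar (u.adicCompletion F) Circle), ψ.IsContinuousNontrivial →
        ∀ [MeasurableSpace (u.adicCompletion F)] [BorelSpace (u.adicCompletion F)]
          [MeasurableSpace (GL (Fin 1) (u.adicCompletion F) ⧸ upperUnitriangular (Fin 1) (u.adicCompletion F))]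
          [BorelSpace (GL (Fin 1) (u.adicCompletion F) ⧸ upperUnitriangular (Fin 1) (u.adicCompletion F))]
          (ν : Measure (GL (Fin 1) (u.adicCompletion F) ⧸ upperUnitriangular (Fin 1) (u.adicCompletion F)))
          [SMulInvariantMeasure (GL (Fin 1) (u.adicCompletion F))
            (GL (Fin 1) (u.adicCompletion F) ⧸ upperUnitriangular (Fin 1) (u.adicCompletion F)) ν]
          [IsFiniteMeasureOnCompacts ν] [ν.IsOpenPosMeasure],
          HasRSLFactor Nat.one_lt_two πu.ρ
            (Representation.trivial ℂ (GL (Fin 1) (u.adicCompletion F)) ℂ) ψ ν (P u)) →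
      (∀ (u : HeightOneSpectrum (𝓞 F)) (πu : SmoothIrrep (GL (Fin 2) (u.adicCompletion F))),
        π.transposeInv.1.HasLocalComponentAt u πu.ρ →
        ∀ (ψ : AddChar (u.adicCompletion F) Circle), ψ.IsContinuousNontrivial →
        ∀ [MeasurableSpace (u.adicCompletion F)] [BorelSpace (u.adicCompletion F)]
          [MeasurableSpace (GL (Fin 1) (u.adicCompletion F) ⧸ upperUnitriangular (Fin 1) (u.adicCompletion F))]
          [BorelSpace (GL (Fin 1) (u.adicCompletion F) ⧸ upperUnitriangular (Fin 1) (u.adicCompletion F))]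
          (ν : Measure (GL (Fin 1) (u.adicCompletion F) ⧸ upperUnitriangular (Fin 1) (u.adicCompletion F)))
          [SMulInvariantMeasure (GL (Fin 1) (u.adicCompletion F))
            (GL (Fin 1) (u.adicCompletion F) ⧸ upperUnitriangular (Fin 1) (u.adicCompletion F)) ν]
          [IsFiniteMeasureOnCompacts ν] [ν.IsOpenPosMeasure],
          HasRSLFactor Nat.one_lt_two πu.ρ
            (Representation.trivial ℂ (GL (Fin 1) (u.adicCompletion F)) ℂ) ψ ν (P' u)) →
      ∃ (c₀ : ℝ) (Z Z' J J' Γ Γ' η : ℂ → ℂ),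
        Differentiable ℂ Z ∧ Differentiable ℂ Z' ∧ Differentiable ℂ J ∧ Differentiable ℂ J' ∧
        Differentiable ℂ Γ ∧ Differentiable ℂ Γ' ∧
        (∃ Y : Set ℝ, Y.Finite ∧ ∀ s, Γ s = 0 → s.im ∈ Y) ∧
        (∃ Y : Set ℝ, Y.Finite ∧ ∀ s, Γ' s = 0 → s.im ∈ Y) ∧
        (∀ s : ℂ, c₀ < s.re → J s ≠ 0 ∧ Z s * Γ s =
          J s * ∏' u : HeightOneSpectrum (𝓞 F), ((P u).eval ((u.residueCard : ℂ) ^ (-s)))⁻¹) ∧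
        (∀ s : ℂ, c₀ < s.re → J' s ≠ 0 ∧ Z' s * Γ' s =
          J' s * ∏' u : HeightOneSpectrum (𝓞 F), ((P' u).eval ((u.residueCard : ℂ) ^ (-s)))⁻¹) ∧
        (∀ s, Z s = Z' (1 - s)) ∧
        Continuous η ∧ (∀ s, η s ≠ 0) ∧ (∀ s, J' (1 - s) = η s * J s)) :
    frobSatakeCompatibleAt_of_isPiOfArtinRep_of_isUnramifiedAt :=
  frobSatakeCompatibleAt_of_isPiOfArtinRep_of_isUnramifiedAt_of_JacquetLanglands1970_standardLTheoryGL2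
    (JacquetLanglands1970_standardLTheoryGL2_of_integralRepresentation hIR)

end Facts

end Literature.NumberTheory.Automorphic

end
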